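/-
Origin: expansion seat `literature-prover-pub-hodgecm-cf-kudla-howe-rallis-g7-0`, handover cf-kudla-howe-rallis-g7 ; 2026-08-18T14:27:08Z (`HOME/pub-hodgecm-cf-kudla-howe-rallis-g7/lean/CfKHRg7/LiuCMData.lean`, md5 39a1a3e2, 231 lines);
landed by the gen-8 packager in gate run 31 as `HodgeCM/Literature/LiuCMData.lean` (verbatim).
-/
/-
Copyright (c) 2026 the pub-hodgecm formalisation cell (harness21).  New file, not vendored.
Origin: HOME/pub-hodgecm-cf-kudla-howe-rallis-g7/lean/CfKHRg7/LiuCMData.lean — session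
literature-prover-pub-hodgecm-cf-kudla-howe-rallis-g7-0 (unit pub-hodgecm-cf-kudla-howe-rallis-g7, CITED-FACT seat (4)
theta / Howe / Siegel–Weil / Rallis, gen 7).  Intended final place: `HodgeCM/Literature/LiuCMData.lean` (NEW additive leaf;
imports the landed tree modules `HodgeCM.Literature.AlbaneseUnitaryShimura` (this lineage, run 25) and `HodgeCM.CM.TypeOfDet`
(node prover 04 gen 7, run 29) + Mathlib; no WIP import, no rewrite; nothing imports it).  Companion prose: HOME/CITED-FACTS.md
§ pub-hodgecm-cf-kudla-howe-rallis-g7, record KHR-43.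
-/
import Mathlib
import Summits.HodgeConjecture.HodgeCM.Literature.AlbaneseUnitaryShimura
import Summits.HodgeConjecture.HodgeCM.CM.TypeOfDet

set_option autoImplicit false

/-!
# Cited: Liu's CM data for a weight-one character — [Liu21] Def. 4.5, Prop. 4.6 (1) — and the
# determinant-to-type bridge BY NAME

[Liu21] = Yifeng Liu, *Fourier–Jacobi cycles and arithmetic relative trace formula* (with an appendix by Chao Li and
Yihang Zhu), Cambridge J. Math. **9** (2021), no. 1, 1–147 = arXiv:2102.11518, §4.1 "CM data" (held extraction
`paper:arxiv-2102.11518`, chunks p0018 L53 – p0019 L12, p0023 L1; author's TeX source `FJcycle.tex` ll. 1936–1987, 2246–2247,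
cell-readable copy `HOME/pub-hodgecm-cf-kudla-howe-rallis-g4/lit/Liu21-arxiv-src/`).  Numbering = the compiled arXiv version
(the Cambridge J. Math. numbering is unconfirmed, acquisition acq-07613 — same caveat as `AlbaneseUnitaryShimura.lean`).

WHY THIS FILE.  `HodgeCM/Literature/AlbaneseUnitaryShimura.lean` (this lineage, runs 20/25) types [Liu21] Prop 4.13, Thm 4.18 (2),
Cor 4.20 over the bare carriers `LiuAlbaneseDatum` and records Def 4.5 only inside the docstring of the carrier `Amu`.  Two
consumers have since asked for Def 4.5 AS A NAMED STATEMENT: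
* node prover 04 gen 7, `HodgeCM/CM/TypeOfDet.lean` (run 29), proves in the kernel (`CMTypeOps.type_eq_inflate_of_det`) that a
  finite set `Θ` of embeddings whose product character is `x ↦ ∏_{σ' ∈ S} σ'(N_{M/M'} x)` IS the inflation of `S`, and states
  (module docstring, "What is NOT claimed"): "[Liu21] Def 4.5(1) itself and '`Lie_E(A_μ) ⊗_{E,ι₁} ℂ` is the direct sum of the
  eigenlines of a multiplicity-free set `Θ` …' stay print";
* expansion prover a-2 gen 7 (`HOME/pub-hodgecm-prl2-g7/SUCCESSOR-byname-TypeMatch.md`, item (1)): the P-IF hypothesis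
  `BMMDict.TypeMatch` of `HodgeCM/StubTree/ThetaSpanFromBMM.lean` (run 30) "IS" the sentence of `LiuAlbaneseDatum.Cor420`'s
  docstring "identify `A_μ` (CM by `M_μ ⊇ M'_μ =` reflex field of `(L, Φ_μ)`, …) with a power of the simple CM abelian variety of
  REFLEX type"; a by-name version needs "a typed Def 4.5(1) … Keep AS-PRINTED discipline: Def 4.5 is a DEFINITION of the category
  `𝒜(μ)`; Prop 4.6 (non-emptiness via [Shi71]) is the theorem."
This file supplies exactly that, in the style of the lineage's other records (bare carriers; the published sentence typed as a
`def … : Prop`; the readings a consumer must add typed as SEPARATE named `Prop`s so that nothing is smuggled; the consequence PerL's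
readers draw PROVED from them by name).  Nothing is asserted.  No statement of the 2001 programme, of PerL or of [QW8] is used.

AS PRINTED (author's TeX, macros resolved as in `AlbaneseUnitaryShimura.lean` v3: `\eta_\mu` = `η_μ`, `\cA(\mu)` = `𝒜(μ)`,
`\mu^\alg` = `μ^{alg}`):

* **Def. 4.5** (`FJcycle.tex` ll. 1936–1963; chunk p0018 L53–77).  "Let `μ` be a conjugate symplectic automorphic character of
  weight one.  (1) We denote by `η'_μ : Res_{M'_μ/ℚ}𝔾_m → Res_{E/ℚ}𝔾_m` the reciprocity map, and put
  `η_μ := η'_μ ∘ Nm_{M_μ/M'_μ} : Res_{M_μ/ℚ}𝔾_m → Res_{E/ℚ}𝔾_m`.  (2) We define a *CM data for `μ`* to be a quadruple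
  `D_μ = (A_μ, i_μ, λ_μ, r_μ)`, in which • `A_μ` is an abelian variety over `E`, • `i_μ : M_μ → End_E(A_μ)_ℚ` is a CM structure
  such that – for every `x ∈ M_μ`, the determinant of the action of `i_μ(x)` on the `E`-vector space `Lie_E(A_μ)` equals `η_μ(x)`,
  – the associated CM character of `A_μ` with respect to the inclusion `M_μ ↪ ℂ` coincides with `μ^{alg}`, • `λ_μ : A_μ → A_μ^∨`
  is a polarization satisfying `λ ∘ i_μ(x) = i_μ(x̄)^∨ ∘ λ` for every `x ∈ M_μ`, • `r_μ : M_μ ⊗_ℚ E → H_1^{dR}(A_μ/E)` is an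
  isomorphism of `M_μ ⊗_ℚ E`-modules satisfying [a trace condition on the `λ`-pairing].  (3) We denote by `𝒜(μ)` the *category
  of CM data for `μ`*, whose objects are CM data `D_μ`, and morphisms … are isogenies `φ : A_μ → A'_μ` satisfying
  `φ ∘ i_μ(x) = i'_μ(x) ∘ φ` …"  Here (Def. 4.3 (2), chunk p0018 L41–42) "`M'_μ ⊆ ℂ` [is] the reflex field of `(E, Φ_μ)`, with the
  induced CM type `Ψ_μ`", and "`M_μ ⊆ ℂ` the subfield generated by values `μ^{alg}(x)` …, a number field containing `M'_μ`".
* **Prop. 4.6** (ll. 1966–1987; chunk p0018 L79–84, proof p0019 L1–12).  "Let `μ` be as in Definition 4.5.  (1) The category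
  `𝒜(μ)` is a nonempty and connected partially ordered set.  (2) The assignment sending `D_μ` to `D_μ^∨` induces an equivalence
  `𝒜(μ)^{op} ≃ 𝒜(μ^c)` of categories."  Proof of non-emptiness, as printed: "By Casselman's theorem [Shi71, Theorem 6], we have a
  pair `(A', i')` where `A'` is an abelian variety over `E'` and `i' : M'_μ → End_{E'}(A')_ℚ` is a CM structure such that • the
  determinant of the action of `i'(x')` on the `E'`-vector space `Lie_{E'}(A')` is `η'_μ(x')` for every `x' ∈ M'_μ`, • the associated
  CM character of `A'` … coincides with `μ^{alg ′}`.  By [Shi71, Lemma 1 & Lemma 2], `A'` is simple, hence `i'` is an isomorphism.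
  The same argument in [Den89, (2.1)] implies that there is an isogeny factor `A_μ` of the abelian variety `Res_{E'/E} A'` over `E`
  together with a CM structure `i_μ : M_μ → End_E(A_μ)_ℚ` satisfying the conditions in the proposition. … By [Shi71, Theorem 5], we
  know the existence of `λ_μ`."  ([Shi71] = G. Shimura, *On the zeta-function of an abelian variety with complex multiplication*,
  Ann. of Math. 94 (1971); [Den89] = C. Deninger, *Higher regulators and Hecke L-series of imaginary quadratic fields I*, Invent. Math.
  96 (1989) — Liu's bibliography.)
* **Thm. 4.18, first sentence of the proof** (ll. 2246–2247; chunk p0023 L1): "Take an embedding `τ' : E → ℂ` in `Φ_μ`.  It is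
  clear that the maximal subspace of the complex vector space `H¹_{B,τ'}(A_μ, ℂ)` over which `M_μ` acts via the inclusion `M_μ ↪ ℂ`
  has dimension `1`."

TYPING.  One object `D_μ ∈ 𝒜(μ)` at ONE `μ` is the structure `LiuCMData E`: the number fields `M = M_μ ⊇ M' = M'_μ` (a tower,
`Algebra M' M`), the reciprocity map on points `etaPrime : M' → E` (print: a homomorphism of tori `Res_{M'_μ/ℚ}𝔾_m → Res_{E/ℚ}𝔾_m`;
only its values on `M' ∖ {0}` are ever used) and the determinant character `detLie : M → E`, `x ↦ det(i_μ(x) | Lie_E(A_μ))`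
(print: defined for all `x ∈ M_μ` through `i_μ : M_μ → End_E(A_μ)_ℚ`; only `x ≠ 0` is used).  The polarization `λ_μ`, the de Rham
trivialisation `r_μ`, the morphisms of `𝒜(μ)` and Prop. 4.6 (2) are NOT typed (nothing in the cell uses them).  The FIRST bullet
of Def. 4.5 (2) is the `Prop` `LiuCMData.Def45_det` (quantified over `x ≠ 0` — weaker than print, never stronger); the SECOND bullet
(the CM character of `A_μ` is `μ^{alg}`) is recorded, not typed (its home is `LiuAlbaneseDatum.Amu`'s docstring and the Galois side
of Thm. 4.18, which the cell does not formalise).  Prop. 4.6 (1) is the EXISTENCE statement that licenses positing an inhabitant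
`C : LiuCMData E` with `C.Def45_det` for every weight-one `μ` — exactly as `LiuAlbaneseDatum.Amu : Char → Isog` posits Liu's
`A_μ`; over bare carriers a `Prop` "`𝒜(μ)` is nonempty" would be vacuous, so Prop. 4.6 (1) is carried as the CITATION attached to
the binder (`LiuCMFamily` below), not as a field.

THE BRIDGE (kernel, by name).  A consumer reading `Lie_E(A_μ) ⊗_{E,ι₁} ℂ` as a direct sum of eigenlines indexed by a finite set
`Θ` of embeddings `M_μ → ℂ` (`LieEigenReading`, a READING: linear algebra of the `E ⊗ M_μ`-module `Lie_E(A_μ)` — multiplicity-free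
because `H¹_B(A_μ ⊗_{E,τ'} ℂ, ℚ)` is free of rank one over `M_μ`, the Thm 4.18 proof sentence above; the same reading as node prover 04's
"`Lie ⊗_{E,ι₁} ℂ = ⊕_{θ∈Θ} ℂ_θ`" in `TypeOfDet.lean`) and reading the reciprocity map through `ι₁` as a product over a finite set `S`
of embeddings `M'_μ → ℂ` (`ReflexNormReading` — the DEFINING formula of the reflex norm = Liu's "reciprocity map" of Def. 4.5 (1);
node prover 04 records it as "`ι₁ ∘ N'_μ = ∏_{σ' ∈ Φ'_μ} σ'` the DEFINITION of the reflex norm"; classical source Shimura–Taniyama,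
*Complex multiplication of abelian varieties* (1961) — not held on the hub, no page claimed; for `ι₁ = τ' ∈ Φ_μ` and Liu's
inclusion `M'_μ ⊆ ℂ`, `S` is the induced CM type `Ψ_μ` of Def. 4.3 (2)) obtains
from `Def45_det`, BY NAME of node prover 04's `HodgeCM.CMTypeOps.type_eq_inflate_of_det`, that `Θ` is the INFLATION of `S` to
`M_μ` (`LiuCMData.cmType_eq_inflate_of_det45`).  Which `S` it is for PerL's `ι₁` and how `Θ` is PerL's `Ψ_i` read through `κ` is
the consumers' dictionary (reading R3 of `ThetaModel.Fact_thetaAlbanese`, GAPS pv04g3-C1/C3; prl2's MODEL seams, spec item (3)) —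
not claimed here.

PerL v5 USE: node N12a / N05 (CM typing of theta one-forms; `inputs/2001/…paper-v5-d912a121.tex` ll. 183–206, 280–284) through
`ThetaModel.Fact_thetaAlbanese` (R3) and `BMMDict.TypeMatch`.  MISMATCH between PerL's need and print: none at the level of
Def. 4.5 / Prop. 4.6; the residual is dictionary (above), unchanged from `LiuAlbaneseDatum.Cor420`'s MISMATCH note.
-/

noncomputable section

universe u

namespace HodgeCM.Literature.Theta

/-- **Carriers of one CM datum `D_μ = (A_μ, i_μ, λ_μ, r_μ) ∈ 𝒜(μ)`** ([Liu21] Def. 4.5, chunk p0018 L53–77) for ONE conjugate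
symplectic automorphic character `μ` of weight one of the CM field `E` (`E` any field here; in [Liu21] a CM extension `E/F`; in
PerL v5 `E = L`, `F = L₀` — the CM field `L ⊃ K` over which the unitary groups live, NOT the sextic field `K` itself; pv14-G1):
* `M` — `M_μ ⊆ ℂ`, "the subfield generated by values `μ^{alg}(x)` …, a number field containing `M'_μ`" (Def. 4.3, p0018 L42);
* `M'` — `M'_μ ⊆ ℂ`, "the reflex field of `(E, Φ_μ)`, with the induced CM type `Ψ_μ`" (Def. 4.3 (2), p0018 L41), with the
  inclusion `M'_μ ⊆ M_μ` as the `Algebra M' M` structure;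
* `etaPrime` — the reciprocity map `η'_μ : Res_{M'_μ/ℚ}𝔾_m → Res_{E/ℚ}𝔾_m` (Def. 4.5 (1)) on points, typed as a bare function
  `M' → E` (only its values on `M' ∖ {0}` are used);
* `detLie` — `x ↦` "the determinant of the action of `i_μ(x)` on the `E`-vector space `Lie_E(A_μ)`" (Def. 4.5 (2)), a bare
  function `M → E` (the abelian variety `A_μ` over `E`, its CM structure `i_μ : M_μ → End_E(A_μ)_ℚ` and `Lie_E(A_μ)` are not
  carried — Mathlib has no abelian varieties; their classes live in `LiuAlbaneseDatum.Isog` / `Amu`). -/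
structure LiuCMData (E : Type u) [Field E] where
  /-- `M_μ` -/
  M : Type u
  [instFieldM : Field M]
  [instNumberFieldM : NumberField M]
  /-- `M'_μ`, the reflex field of `(E, Φ_μ)` -/
  M' : Type u
  [instFieldM' : Field M']
  [instNumberFieldM' : NumberField M']
  /-- `M'_μ ⊆ M_μ` -/
  [instAlgebra : Algebra M' M]
  /-- `η'_μ` on points: the reciprocity map `M'_μ^× → E^×` (Def. 4.5 (1)) -/
  etaPrime : M' → E
  /-- `x ↦ det(i_μ(x) | Lie_E(A_μ))` (Def. 4.5 (2), first bullet) -/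
  detLie : M → E

attribute [instance] LiuCMData.instFieldM LiuCMData.instNumberFieldM LiuCMData.instFieldM'
  LiuCMData.instNumberFieldM' LiuCMData.instAlgebra

namespace LiuCMData

variable {E : Type u} [Field E] (C : LiuCMData.{u} E)

/-- **[Liu21, Def. 4.5 (1)]**: `η_μ := η'_μ ∘ Nm_{M_μ/M'_μ}` (on points: `x ↦ η'_μ(N_{M_μ/M'_μ} x)`, `Algebra.norm M'`). -/
def eta (x : C.M) : E :=
  C.etaPrime (Algebra.norm C.M' x)

/-- (Ported verbatim from the HodgeCMPerL package; no docstring in the source.) -/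
theorem eta_def (x : C.M) : C.eta x = C.etaPrime (Algebra.norm C.M' x) := rfl

/-- **[Liu21, Def. 4.5 (2), first bullet]**, AS PRINTED: "for every `x ∈ M_μ`, the determinant of the action of `i_μ(x)` on the
`E`-vector space `Lie_E(A_μ)` equals `η_μ(x)`" — typed for `x ≠ 0` (the reciprocity map is a map of tori; weaker than print, never
stronger).  This is the DEFINING property of an object of `𝒜(μ)`; that such an object EXISTS is [Liu21, Prop. 4.6 (1)] ("The
category `𝒜(μ)` is a nonempty and connected partially ordered set", via Casselman's theorem [Shi71, Thm 6], [Shi71, Lemmas 1–2,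
Thm 5] and [Den89, (2.1)] — proof chunk p0019 L1–12), which is the citation a consumer attaches to a posited `C` with
`C.Def45_det`. -/
def Def45_det : Prop :=
  ∀ x : C.M, x ≠ 0 → C.detLie x = C.eta x

/-- **READING (linear algebra; labelled, not print by name)**: after the base change `ι₁ : E → ℂ`, `Lie_E(A_μ) ⊗_{E,ι₁} ℂ` is the
direct sum of the eigenlines `ℂ_θ`, `θ` running over a finite SET `Θ` of embeddings `M_μ → ℂ` (multiplicity-free because
`H¹_B(A_μ ⊗_{E,ι₁} ℂ, ℚ)` is a free `M_μ`-module of rank one — [Liu21] proof of Thm 4.18, chunk p0023 L1: "the maximal subspace of …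
`H¹_{B,τ'}(A_μ, ℂ)` over which `M_μ` acts via the inclusion `M_μ ↪ ℂ` has dimension `1`"; the same reading as node prover 04's
"`Lie ⊗_{E,ι₁} ℂ = ⊕_{θ ∈ Θ} ℂ_θ`" in `HodgeCM/CM/TypeOfDet.lean`), so that `ι₁(det(i_μ(x) | Lie_E(A_μ))) = ∏_{θ ∈ Θ} θ(x)`.  `Θ` is
the CM type of `A_μ ⊗_{E,ι₁} ℂ` as an `M_μ`-CM abelian variety. -/
def LieEigenReading (ι₁ : E →+* ℂ) (Θ : Finset (C.M →+* ℂ)) : Prop :=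
  ∀ x : C.M, x ≠ 0 → ι₁ (C.detLie x) = ∏ θ ∈ Θ, θ x

/-- **READING (the defining formula of the reciprocity map; labelled, not print by name)**: read through `ι₁ : E → ℂ`, the
reciprocity map `η'_μ` of the CM type `(E, Φ_μ)` is the TYPE NORM of a finite set `S` of embeddings `M'_μ → ℂ`:
`ι₁(η'_μ(y)) = ∏_{σ' ∈ S} σ'(y)` for `y ∈ M'_μ^×` (the "reciprocity map" of [Liu21] Def. 4.5 (1) unfolded; node prover 04's
"`ι₁ ∘ N'_μ = ∏_{σ' ∈ Φ'_μ} σ'`, the DEFINITION of the reflex norm" in `HodgeCM/CM/TypeOfDet.lean`; classical source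
Shimura–Taniyama (1961), not held on the hub, no page claimed; for `ι₁ = τ' ∈ Φ_μ` and Liu's `M'_μ ⊆ ℂ`, `S = Ψ_μ`, the induced CM
type of the reflex field, [Liu21] Def. 4.3 (2)).  Which `S` belongs to PerL's `ι₁` is the consumer's dictionary (reading R3 of
`ThetaModel.Fact_thetaAlbanese`; GAPS pv04g3-C1/C3). -/
def ReflexNormReading (ι₁ : E →+* ℂ) (S : Finset (C.M' →+* ℂ)) : Prop :=
  ∀ y : C.M', y ≠ 0 → ι₁ (C.etaPrime y) = ∏ σ' ∈ S, σ' y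

variable {C}

/-- Under `Def45_det` and the two readings, the product character of `Θ` is the type norm of `S` composed with `N_{M_μ/M'_μ}` —
the hypothesis `hdet` of node prover 04's `CMTypeOps.type_eq_inflate_of_det`, verbatim. -/
theorem prod_apply_eq_of_det45 (h : C.Def45_det) {ι₁ : E →+* ℂ} {Θ : Finset (C.M →+* ℂ)} {S : Finset (C.M' →+* ℂ)}
    (hΘ : C.LieEigenReading ι₁ Θ) (hS : C.ReflexNormReading ι₁ S) (x : C.M) (hx : x ≠ 0) :
    ∏ θ ∈ Θ, θ x = ∏ σ' ∈ S, σ' (Algebra.norm C.M' x) := by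
  haveI : IsScalarTower ℚ C.M' C.M := IsScalarTower.of_algebraMap_eq' (Subsingleton.elim _ _)
  haveI : Module.Finite C.M' C.M := Module.Finite.of_restrictScalars_finite ℚ C.M' C.M
  have hN : Algebra.norm C.M' x ≠ 0 := Algebra.norm_ne_zero_iff.mpr hx
  rw [← hΘ x hx, h x hx, eta_def, hS _ hN]

/-- **The CM type of `A_μ` (over `ι₁`) is the INFLATION to `M_μ` of `S`** — [Liu21] Def. 4.5 (2) first bullet (`Def45_det`, print)
+ the two labelled readings, BY NAME of `HodgeCM.CMTypeOps.type_eq_inflate_of_det` (node prover 04 gen 7, run 29; multiplicative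
independence of embeddings + `∏_{σ'∈S} σ'(N_{M/M'} x) = ∏_{θ|_{M'} ∈ S} θ x`): `Θ = {θ : M_μ → ℂ | θ|_{M'_μ} ∈ S}`.  This is the
first inference of reading R3 of `ThetaModel.Fact_thetaAlbanese` ("the `M_μ`-CM type of `A_μ ⊗_{E,ι₁} ℂ` is the inflation of the
reflex type, not of its conjugate", GAPS pv04g3-C3 (2)) with its print leaf now a named hypothesis. -/
theorem cmType_eq_inflate_of_det45 [DecidableEq (C.M' →+* ℂ)] (h : C.Def45_det) {ι₁ : E →+* ℂ}
    {Θ : Finset (C.M →+* ℂ)} {S : Finset (C.M' →+* ℂ)} (hΘ : C.LieEigenReading ι₁ Θ) (hS : C.ReflexNormReading ι₁ S) :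
    Θ = Finset.univ.filter (fun θ : C.M →+* ℂ => θ.comp (algebraMap C.M' C.M) ∈ S) :=
  HodgeCM.CMTypeOps.type_eq_inflate_of_det S Θ (prod_apply_eq_of_det45 h hΘ hS)

/-- Membership form: an embedding `θ : M_μ → ℂ` is an eigencharacter of `Lie_E(A_μ) ⊗_{E,ι₁} ℂ` iff its restriction to `M'_μ`
lies in `S`. -/
theorem mem_cmType_iff_of_det45 [DecidableEq (C.M' →+* ℂ)] (h : C.Def45_det) {ι₁ : E →+* ℂ}
    {Θ : Finset (C.M →+* ℂ)} {S : Finset (C.M' →+* ℂ)} (hΘ : C.LieEigenReading ι₁ Θ) (hS : C.ReflexNormReading ι₁ S)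
    (θ : C.M →+* ℂ) : θ ∈ Θ ↔ θ.comp (algebraMap C.M' C.M) ∈ S := by
  rw [cmType_eq_inflate_of_det45 h hΘ hS]
  simp

end LiuCMData

/-- **A CM datum for every weight-one character** — the family form a consumer of `LiuAlbaneseDatum D` posits ([Liu21] Prop. 4.6 (1):
`𝒜(μ)` is nonempty for every conjugate symplectic `μ` of weight one, i.e. for every `μ : D.Char`): `data μ` = a chosen
`D_μ ∈ 𝒜(μ)` (whose `A_μ` is the class `D.Amu μ`), with Def. 4.5 (2) first bullet at every `μ`. -/
structure LiuCMFamily (E : Type u) [Field E] (D : LiuAlbaneseDatum.{u}) where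
  /-- the chosen object `D_μ ∈ 𝒜(μ)` ([Liu21] Prop. 4.6 (1)) -/
  data : D.Char → LiuCMData.{u} E
  /-- [Liu21] Def. 4.5 (2), first bullet, for the chosen object -/
  def45 : ∀ μ : D.Char, (data μ).Def45_det

namespace LiuCMFamily

variable {E : Type u} [Field E] {D : LiuAlbaneseDatum.{u}} (F : LiuCMFamily E D)

/-- The bridge, per character: the CM type of `A_μ ⊗_{E,ι₁} ℂ` is the inflation of `S_μ` whenever the two readings hold at `μ`. -/
theorem cmType_eq_inflate (μ : D.Char) [DecidableEq ((F.data μ).M' →+* ℂ)] {ι₁ : E →+* ℂ}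
    {Θ : Finset ((F.data μ).M →+* ℂ)} {S : Finset ((F.data μ).M' →+* ℂ)}
    (hΘ : (F.data μ).LieEigenReading ι₁ Θ) (hS : (F.data μ).ReflexNormReading ι₁ S) :
    Θ = Finset.univ.filter (fun θ : (F.data μ).M →+* ℂ => θ.comp (algebraMap (F.data μ).M' (F.data μ).M) ∈ S) :=
  LiuCMData.cmType_eq_inflate_of_det45 (F.def45 μ) hΘ hS

end LiuCMFamily

end HodgeCM.Literature.Theta

end
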